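import Literature.NumberTheory.Sieve.Polymath8aDiscrepancy
import Literature.Barriers.Parity.SiegelZeroDichotomyPairHLSmoothSampling
import HarnessLib

/-!
# Polymath 8a, §3: the Type 0 case of the proof of Lemma 2.7 (one long smooth factor)

Support file for the named fact `Literature.NumberTheory.Sieve.mpz_of_lt` (**parity.S29**,
`ParityWave0.lean`): D. H. J. Polymath, *New equidistribution estimates of Zhang type*, Algebra &
Number Theory 8:9 (2014) 2067–2199 = arXiv:1402.0811.  In the proof of Lemma 2.7 (§3) the
Heath-Brown identity and a finer-than-dyadic decomposition reduce `MPZ^{(i)}[ϖ, δ]` to estimates for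
`∑_{q ∈ 𝒬} |Δ(α_1 ⋆ ⋯ ⋆ α_{2j}; a (q))|` with `α_k` at scales `N_k ∼ x^{t_k}`, `∑ t_k = 1`, and
Lemma 3.1 (in the tree: `Polymath8a.combinatorialLemma`) sorts the exponents into the Type 0 / I–II /
III alternatives.  "It remains to prove (3.9) in the Type 0 case, and we can do this directly": one
factor `α_k` is smooth at a scale `N_k ≫ x^{1/2+σ}` exceeding the level `Q ⪅ x^{1/2+2ϖ}`, and
`∑_{q ∈ 𝒬} |Δ(α_1 ⋆ ⋯ ⋆ α_{2j}; a (q))| ⪅ N_S ∑_{q ≤ Q} sup_b |Δ(α_k; b (q))| ⪅ N_S N_k (Q/N_k)² ≪ x^{1−2σ+4ϖ}`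
by Poisson summation.  This file PROVES that case in explicit form:

* `abs_apDiscrepancy_le_of_classSum` — if every class sum of `α` modulo `q` is within `E` of a
  common value, then `|Δ(α; a (q))| ≤ 2E` (the coprime mean is an average of `φ(q)` class sums);
* `sum_abs_apDiscrepancy_mul_le_of_classSum` — with the §3 identity
  `Δ(β ⋆ α; a (q)) = ∑_{u} (∑_{d ≡ u} β(d)) Δ(α; ū a (q))` (`abs_apDiscrepancy_mul_le`,
  `Polymath8aDiscrepancy.lean`): `∑_{q ∈ 𝒬} |Δ(β ⋆ α; a_q (q))| ≤ (∑|β|) · 2E · ∑_{q ∈ 𝒬} q` when the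
  class-sum error is `E q`;
* `abs_classSum_sub_le_of_smooth` — Poisson summation: for `g ∈ C_c^∞(ℝ)` vanishing outside
  `(1/2, X + 1/2)`, `|∑_{n ≤ X, n ≡ b (q)} g(n) − q⁻¹ ∫ g| ≤ (q/12) ∫|g''|` (the tree's
  `Literature.Barriers.Parity.TaoTeravainen.norm_tsum_sub_div_integral_le`, Poisson summation with
  second-derivative decay, on the lattice `b + qℤ`);
* `typeZero_sum_abs_apDiscrepancy_le` — the Type 0 estimate:
  `∑_{q ∈ 𝒬} |Δ(β ⋆ α; a_q (q))| ≤ (∑_d |β(d)|) · (1/6) ∫|g''| · ∑_{q ∈ 𝒬} q` for `α` interpolated on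
  its support by such a `g` — with `g = ψ(·/N_k)`, `∫|g''| = N_k^{-1} ∫|ψ''|`, this is the printed
  `⪅ N_S Q²/N_k`.

The asymptotic bookkeeping of §3 (the choice `ψ = ψ_N` of the partition of unity, `∑|α_S| ⪅ N_S`,
`N_k ≫ x^{1/2+σ}`, `σ > 2ϖ`) is not performed here; the theorem is the uniform inequality it rests on.
Nothing here discharges `mpz_of_lt`.

## References

* D. H. J. Polymath, *New equidistribution estimates of Zhang type*, Algebra & Number Theory 8:9
  (2014), 2067–2199, arXiv:1402.0811: §3, proof of Lemma 2.7, the Type 0 case (last page of §3).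
  [cite: Polymath8a2014]
* T. Tao, J. Teräväinen, *The Hardy–Littlewood–Chowla conjecture in the presence of a Siegel zero*,
  J. London Math. Soc. 106 (2022), proof of Prop. 7.1 (the Poisson-summation sampling lemma reused
  from `SiegelZeroDichotomyPairHLSmoothSampling.lean`). [cite: TaoTeravainen2021]
-/

open Finset MeasureTheory
open scoped ContDiff

namespace Literature.NumberTheory.Sieve

namespace Polymath8a

section Algebra

variable {q : ℕ}

/-- If every class sum `∑_{n ≤ X, n ≡ b (q)} α(n)` is within `E` of one and the same quantity `m`,
then `|Δ(α; a (q))| ≤ 2E` for every `a` (the coprime mean is an average of `φ(q)` class sums).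
This is how the Type 0 case of Polymath 8a §3 passes from Poisson summation in each class to the
discrepancy ("Since by definition `Δ(α_k; b (q)) = ∑_{n = b (q)} α_k(n) − (1/φ(q)) ∑_c ∑_{n = c (q)} α_k(n)`,
we get `Δ(α_k; b (q)) ⪅ (N_k/q)(N_k/q)^{-2}`"). [cite: Polymath8a2014, §3, proof of Lemma 2.7 (Type 0 case)] -/
theorem abs_apDiscrepancy_le_of_classSum [NeZero q] (α : ℕ → ℝ) (X : ℕ) {m E : ℝ}
    (hE : ∀ b : ZMod q, |∑ n ∈ Icc 1 X with ((n : ℕ) : ZMod q) = b, α n - m| ≤ E) (a : ZMod q) :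
    |apDiscrepancy α X q a| ≤ 2 * E := by
  classical
  have hφ : (0 : ℝ) < q.totient := by exact_mod_cast Nat.totient_pos.mpr (NeZero.pos q)
  have hcard : (Finset.univ : Finset (ZMod q)ˣ).card = q.totient := by
    rw [Finset.card_univ, ZMod.card_units_eq_totient]
  -- the coprime mean is within `E` of `m`
  have hmean : |(∑ n ∈ Icc 1 X with Nat.Coprime n q, α n) / (q.totient : ℝ) - m| ≤ E := by
    rw [sum_filter_coprime_eq_sum_units]
    have hrw : (∑ u : (ZMod q)ˣ, ∑ d ∈ Icc 1 X with ((d : ℕ) : ZMod q) = u, α d) / (q.totient : ℝ)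
        - m = (∑ u : (ZMod q)ˣ, (∑ d ∈ Icc 1 X with ((d : ℕ) : ZMod q) = u, α d - m)) /
          (q.totient : ℝ) := by
      rw [Finset.sum_sub_distrib, Finset.sum_const, hcard, nsmul_eq_mul]
      field_simp
    rw [hrw, abs_div, Nat.abs_cast, div_le_iff₀ hφ]
    calc |∑ u : (ZMod q)ˣ, (∑ d ∈ Icc 1 X with ((d : ℕ) : ZMod q) = u, α d - m)|
        ≤ ∑ u : (ZMod q)ˣ, |∑ d ∈ Icc 1 X with ((d : ℕ) : ZMod q) = u, α d - m| :=
          Finset.abs_sum_le_sum_abs _ _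
      _ ≤ ∑ _u : (ZMod q)ˣ, E := Finset.sum_le_sum fun u _ => hE u
      _ = E * q.totient := by rw [Finset.sum_const, hcard, nsmul_eq_mul, mul_comm]
  rw [apDiscrepancy]
  have h1 := hE a
  have key : ∀ S M : ℝ, |S - m| ≤ E → |M - m| ≤ E → |S - M| ≤ 2 * E := fun S M hS hM => by
    calc |S - M| = |(S - m) - (M - m)| := by ring_nf
      _ ≤ |S - m| + |M - m| := abs_sub _ _
      _ ≤ E + E := add_le_add hS hM
      _ = 2 * E := by ring
  exact key _ _ h1 hmean

/-- **The Type 0 mechanism, summed over moduli** (Polymath 8a §3, last display of the proof of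
Lemma 2.7): if `β` is supported on `[1, X₁]`, `α` on `[1, X₂]`, `X₁ X₂ ≤ X`, and for every modulus
`q` in a finite set `𝒬 ⊆ [1, ∞)` every class sum of `α` modulo `q` is within `E q` of a quantity `m_q`,
then for any primitive residues `a_q`,
`∑_{q ∈ 𝒬} |Δ(β ⋆ α; a_q (q))| ≤ (∑_d |β(d)|) · 2E · ∑_{q ∈ 𝒬} q`
(from `abs_apDiscrepancy_mul_le` and `abs_apDiscrepancy_le_of_classSum`).
[cite: Polymath8a2014, §3, proof of Lemma 2.7 (Type 0 case)] -/
theorem sum_abs_apDiscrepancy_mul_le_of_classSum (β α : ArithmeticFunction ℝ) {X₁ X₂ X : ℕ}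
    (hβ : ∀ n, X₁ < n → β n = 0) (hα : ∀ n, X₂ < n → α n = 0) (hX : X₁ * X₂ ≤ X)
    (𝒬 : Finset ℕ) (h𝒬 : ∀ q ∈ 𝒬, 0 < q) (a : ∀ q : ℕ, (ZMod q)ˣ) {E : ℝ} (m : ℕ → ℝ)
    (hE : ∀ q ∈ 𝒬, ∀ b : ZMod q,
      |∑ n ∈ Icc 1 X₂ with ((n : ℕ) : ZMod q) = b, α n - m q| ≤ E * q) :
    ∑ q ∈ 𝒬, |apDiscrepancy ⇑(β * α) X q (a q)| ≤
      (∑ d ∈ Icc 1 X₁, |β d|) * (2 * E) * ∑ q ∈ 𝒬, (q : ℝ) := by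
  rw [Finset.mul_sum]
  refine Finset.sum_le_sum fun q hq => ?_
  haveI : NeZero q := ⟨(h𝒬 q hq).ne'⟩
  have hB : ∀ b : (ZMod q)ˣ, |apDiscrepancy α X₂ q b| ≤ 2 * (E * q) := fun b =>
    abs_apDiscrepancy_le_of_classSum α X₂ (hE q hq) b
  calc |apDiscrepancy ⇑(β * α) X q (a q)| ≤ (∑ d ∈ Icc 1 X₁, |β d|) * (2 * (E * q)) :=
        abs_apDiscrepancy_mul_le β α hβ hα hX (a q) hB
    _ = (∑ d ∈ Icc 1 X₁, |β d|) * (2 * E) * q := by ring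

end Algebra

section Smooth

/-- **Class sums of a smooth sequence** (Poisson summation, as in the Type 0 case of Polymath 8a
§3: "`∑_{n = b (q)} α_k(n) = (N_k/q) ψ̂(0) + (N_k/q) ∑_{m ≠ 0} e_q(mb) ψ̂(m N_k/q)`" with
`|ψ̂(m N_k/q)| ⪅ (m N_k/q)^{-2}`): if `g ∈ C_c^∞(ℝ)` vanishes outside `(1/2, X + 1/2)` and
`α(n) = g(n)` for `1 ≤ n ≤ X`, then for every modulus `q ≥ 1` and every class `b`,
`|∑_{n ≤ X, n ≡ b (q)} α(n) − q⁻¹ ∫ g| ≤ (1/12) q ∫ |g''|` — the tree's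
`TaoTeravainen.norm_tsum_sub_div_integral_le` (Poisson summation with second-derivative decay and
`∑_{n ≠ 0} n⁻² = π²/3`) on the lattice `b + qℤ`. [cite: Polymath8a2014, §3, proof of Lemma 2.7 (Type 0 case)] -/
theorem abs_classSum_sub_le_of_smooth {g : ℝ → ℂ} (hg : ContDiff ℝ ∞ g) (hs : HasCompactSupport g)
    {X : ℕ} (hg₁ : ∀ y : ℝ, y ≤ 1 / 2 → g y = 0) (hg₂ : ∀ y : ℝ, (X : ℝ) + 1 / 2 ≤ y → g y = 0)
    {α : ℕ → ℝ} (hα : ∀ n ∈ Icc 1 X, (α n : ℂ) = g n) {q : ℕ} (hq : 0 < q) (b : ZMod q) :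
    |∑ n ∈ Icc 1 X with ((n : ℕ) : ZMod q) = b, α n - (q : ℝ)⁻¹ * (∫ y, g y).re| ≤
      (1 / 12) * q * ∫ y, ‖iteratedDeriv 2 g y‖ := by
  classical
  haveI : NeZero q := ⟨hq.ne'⟩
  -- the class `b` as the integers `≡ b.val (mod q)`
  set r : ℤ := (b.val : ℤ) with hr
  have hclass : ∀ n : ℕ, ((n : ℕ) : ZMod q) = b ↔ (n : ℤ) ≡ r [ZMOD q] := fun n => by
    rw [hr, Int.ModEq, ← ZMod.intCast_eq_intCast_iff', Int.cast_natCast, Int.cast_natCast,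
      ZMod.natCast_zmod_val]
  have hfilter : (Icc 1 X).filter (fun n : ℕ => ((n : ℕ) : ZMod q) = b) =
      (Icc 1 X).filter (fun n : ℕ => (n : ℤ) ≡ r [ZMOD q]) :=
    Finset.filter_congr fun n _ => hclass n
  -- the class sum as a lattice sum of `g`
  have hsumC : ((∑ n ∈ Icc 1 X with ((n : ℕ) : ZMod q) = b, α n : ℝ) : ℂ) =
      ∑' k : ℤ, g (r + (q : ℝ) * k) := by
    rw [← Literature.Barriers.Parity.TaoTeravainen.sum_filter_modEq_eq_tsum hq r hg₁ hg₂, ← hfilter]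
    push_cast
    exact Finset.sum_congr rfl fun n hn => hα n (Finset.mem_filter.mp hn).1
  have hmain := Literature.Barriers.Parity.TaoTeravainen.norm_tsum_sub_div_integral_le hg hs
    (m := 2) le_rfl (L := (q : ℝ)) (by exact_mod_cast hq) (r : ℝ)
  -- constants: `(π²/3)/(2π)² · q^{2-1} = q/12`
  have hconst : (Real.pi ^ 2 / 3) / (2 * Real.pi) ^ 2 * (q : ℝ) ^ (2 - 1) = (1 / 12) * q := by
    have hπ : Real.pi ≠ 0 := Real.pi_ne_zero
    field_simp
    ring
  rw [hconst] at hmain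
  -- take real parts
  have hre : ∑ n ∈ Icc 1 X with ((n : ℕ) : ZMod q) = b, α n - (q : ℝ)⁻¹ * (∫ y, g y).re =
      ((∑' k : ℤ, g (r + (q : ℝ) * k)) - (q : ℂ)⁻¹ * ∫ y, g y).re := by
    rw [Complex.sub_re, ← hsumC, Complex.ofReal_re]
    congr 1
    rw [show (q : ℂ)⁻¹ = ((q : ℝ)⁻¹ : ℝ) by push_cast; rfl, Complex.re_ofReal_mul]
  rw [hre]
  refine (Complex.abs_re_le_norm _).trans ?_
  simpa using hmain

end Smooth

section TypeZero

/-- **The Type 0 estimate of Polymath 8a §3** (end of the proof of Lemma 2.7): "In this case, there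
exists some `k` such that `t_k ≥ 1/2 + σ` … `α_k` is smooth and has a long support, so that it is very
well-distributed in arithmetic progressions to relatively large moduli, and we can just treat the
remaining `α_j` trivially" — precisely, from
`Δ(α_k ⋆ α_S; a (q)) = ∑_{m ∈ (ℤ/qℤ)ˣ} ∑_{ℓ = m (q)} α_S(ℓ) Δ(α_k; m̄ a (q))`, `∑_m |α_S(m)| ⪅ N_S` and
Poisson summation `Δ(α_k; b (q)) ⪅ (N_k/q)(N_k/q)^{-2}`, the paper gets
`∑_{q ∈ 𝒬} |Δ(α_1 ⋆ ⋯ ⋆ α_{2j}; a (q))| ⪅ N_S N_k (Q/N_k)²`.  Explicit form proved here: for `β`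
(the paper's `α_S`) supported on `[1, X₁]`, `α` (the paper's `α_k`) supported on `[1, X₂]` and
interpolated there by `g ∈ C_c^∞(ℝ)` vanishing outside `(1/2, X₂ + 1/2)`, `X₁ X₂ ≤ X`, any finite
set `𝒬` of moduli `q ≥ 1` and primitive residues `a_q`,
`∑_{q ∈ 𝒬} |Δ(β ⋆ α; a_q (q))| ≤ (∑_d |β(d)|) · (1/6) ∫|g''| · ∑_{q ∈ 𝒬} q`.
(With `g(y) = ψ(y/N_k)`, `∫|g''| = N_k^{-1} ∫|ψ''| ⪅ N_k^{-1}` and `∑_{q ≤ Q} q ≤ Q²` this is the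
printed `⪅ N_S Q²/N_k = x^{1−2σ+4ϖ+o(1)}` for `N_k ≫ x^{1/2+σ}`, `Q ⪅ x^{1/2+2ϖ}`.)
[cite: Polymath8a2014, §3, proof of Lemma 2.7 (Type 0 case)] -/
theorem typeZero_sum_abs_apDiscrepancy_le (β α : ArithmeticFunction ℝ) {X₁ X₂ X : ℕ}
    (hβ : ∀ n, X₁ < n → β n = 0) (hα : ∀ n, X₂ < n → α n = 0) (hX : X₁ * X₂ ≤ X)
    {g : ℝ → ℂ} (hg : ContDiff ℝ ∞ g) (hs : HasCompactSupport g)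
    (hg₁ : ∀ y : ℝ, y ≤ 1 / 2 → g y = 0) (hg₂ : ∀ y : ℝ, (X₂ : ℝ) + 1 / 2 ≤ y → g y = 0)
    (hαg : ∀ n ∈ Icc 1 X₂, (α n : ℂ) = g n)
    (𝒬 : Finset ℕ) (h𝒬 : ∀ q ∈ 𝒬, 0 < q) (a : ∀ q : ℕ, (ZMod q)ˣ) :
    ∑ q ∈ 𝒬, |apDiscrepancy ⇑(β * α) X q (a q)| ≤
      (∑ d ∈ Icc 1 X₁, |β d|) * ((1 / 6) * ∫ y, ‖iteratedDeriv 2 g y‖) * ∑ q ∈ 𝒬, (q : ℝ) := by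
  have h := sum_abs_apDiscrepancy_mul_le_of_classSum β α hβ hα hX 𝒬 h𝒬 a
    (E := (1 / 12) * ∫ y, ‖iteratedDeriv 2 g y‖) (fun q => (q : ℝ)⁻¹ * (∫ y, g y).re)
    (fun q hq b => (abs_classSum_sub_le_of_smooth hg hs hg₁ hg₂ hαg (h𝒬 q hq) b).trans_eq (by ring))
  convert h using 2
  ring

end TypeZero

end Polymath8a

end Literature.NumberTheory.Sieve
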